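import Mathlib
import Summits.AtomisticToContinuum.Crystallization.Theorems.GappedShellCensusCleanLimitsHaveWindowsDefs
import Summits.AtomisticToContinuum.Crystallization.Theorems.PhononSlackCertificatesPeriodicGivenLayeredWindowBounds
import Literature.MathematicalPhysics.StatisticalMechanics.LocalMatchingCompactness
import Literature.MathematicalPhysics.StatisticalMechanics.BarlowStacking
import Literature.Geometry.DiscreteGeometry.KissingPatterns
import Summits.AtomisticToContinuum.Crystallization.Theorems.GappedShellCensusCleanLimitsHaveWindowsBallBoundarySum
import Summits.AtomisticToContinuum.Crystallization.Theorems.GappedShellCensusCleanLimitsHaveWindowsGridCount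
import Summits.AtomisticToContinuum.Crystallization.Theorems.GappedShellCensusCleanLimitsHaveWindowsLaminarDefs
import Summits.AtomisticToContinuum.Crystallization.Theorems.GappedShellCensusCleanLimitsHaveWindowsRelDense
import Summits.AtomisticToContinuum.Crystallization.Theorems.GappedShellCensusCleanLimitsHaveWindowsClosing

/-!
# Crux `GappedShellCensus.CleanLimitsHaveWindows` (stmt-AtomisticToContinuum-15932), line `Sketch`:
# stub R3b `stub_laminarDensityClosing` (density closing at the set for the laminar defect)

For a rooted (`0 ∈ Z`), everywhere-clean, rooted-uniformly recurrent, charted element `Z` of the hull of a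
sequence of Lennard-Jones ground states, laminar coercivity on balls (used only AT `Z`) and the Lipschitz
property of the laminar defect under shell bijections force `laminarDefect a Z p = 0` at every site. This is
the landed density closing `stub_closing` (file `…Closing.lean`) replayed with `laminarDefect` for `localDefect`:

* (A) surface order from above: on `W = Z ∩ B̄(c, L)` the cut-and-paste bound (U)
  (`LayeredHull.stub_windowBounds`) and the ball boundary sum (`stub_ballBoundarySum`) give
  `Σ_W e_p(Z) ≤ 2E(#W) + O(L²)`, and coercivity gives `2E(#W) − CL² + κ Σ_W defect ≤ Σ_W e_p(Z)`, so
  `κ Σ_W defect = O(L²)`;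
* (B) recurrence transfer (`closing_shellEquiv`, `laminarClosing_recur` = `closing_recur` for an arbitrary
  site functional Lipschitz under shell bijections): a defect `η > 0` at one site reappears, up to `η/2`,
  within bounded distance of every point of space; relative denseness is `stub_relDense`;
* (C) volume order from below: a `2G'`-separated grid in `B̄(0, L/2)` (`stub_gridCount`) yields
  `≥ (L/(8G'))³` distinct sites of defect `≥ η/2` in `W`; `L³ ≲ L²` is absurd (`closing_endgame`).
-/

noncomputable section

namespace Summit.AtomisticToContinuum.Crystallization.Theorems.CleanHull

open scoped BigOperators
open Filter Metric
open Literature.MathematicalPhysics.StatisticalMechanics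
open Literature.Geometry.DiscreteGeometry

/-- **Recurrence transfer of a positive site functional.** If `Z` is gapped-twelve at scale `a > 0`,
rooted-uniformly recurrent and `2a`-relatively dense, and the site functional `F` is `K`-Lipschitz under
shell bijections, then a value `F p₀ ≥ η > 0` at one site of `Z` forces, within a uniform distance `D` of
EVERY point of space, a site of `Z` with `F ≥ η/2` (this is `closing_recur` for a general `F`). [folklore] -/
theorem laminarClosing_recur {Z : Set (EuclideanSpace ℝ (Fin 3))} {a : ℝ} (ha : 0 < a)
    (F : EuclideanSpace ℝ (Fin 3) → ℝ) (K : ℝ)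
    (hK : ∀ (p p' : EuclideanSpace ℝ (Fin 3)) (ε : ℝ), 0 ≤ ε → ε ≤ a →
      (∃ f : ↥(bondShell a Z p) ≃ ↥(bondShell a Z p'),
        ∀ w : ↥(bondShell a Z p),
          dist ((f w : EuclideanSpace ℝ (Fin 3)) - p') ((w : EuclideanSpace ℝ (Fin 3)) - p) ≤ ε) →
      |F p - F p'| ≤ K * ε)
    (hgap : ∀ y ∈ Z, {w ∈ Z | w ≠ y ∧ dist y w ≤ a * (1 + 1 / 50)}.ncard = 12 ∧
      ∀ w ∈ Z, w ≠ y → a * (1 - 1 / 50) ≤ dist y w ∧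
        (dist y w ≤ a * (1 + 1 / 50) ∨ a * (63 / 50) ≤ dist y w))
    (hrec : ∀ R ε : ℝ, 0 < ε → ∃ G : ℝ, ∀ w ∈ Z, ∃ g ∈ Z, dist g w ≤ G ∧
      BallMatch ε R 0 ((fun p => p - g) '' Z) Z)
    (hdense : ∀ y : EuclideanSpace ℝ (Fin 3), ∃ w ∈ Z, dist w y ≤ 2 * a)
    {p₀ : EuclideanSpace ℝ (Fin 3)} (hp₀ : p₀ ∈ Z) {η : ℝ} (hη : 0 < η) (hηp : η ≤ F p₀) :
    ∃ D : ℝ, 0 ≤ D ∧ ∀ y : EuclideanSpace ℝ (Fin 3), ∃ p' ∈ Z, dist p' y ≤ D ∧ η / 2 ≤ F p' := by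
  -- adapted from `closing_recur` (…Closing.lean), `F` for `localDefect a Z`
  have hK' : 0 < max K 1 := lt_max_of_lt_right one_pos
  set ε := min (a / 100) (η / (4 * max K 1)) with hεdef
  have hε : 0 < ε := lt_min (by positivity) (by positivity)
  have hεa : ε ≤ a / 100 := min_le_left _ _
  have hεK : K * (2 * ε) ≤ η / 2 := by
    have h2 : K * (2 * ε) ≤ max K 1 * (2 * ε) := mul_le_mul_of_nonneg_right (le_max_left _ _) (by linarith)
    have h3 : max K 1 * ε ≤ max K 1 * (η / (4 * max K 1)) :=
      mul_le_mul_of_nonneg_left (min_le_right _ _) hK'.le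
    have h4 : max K 1 * (η / (4 * max K 1)) = η / 4 := by field_simp
    nlinarith
  obtain ⟨G, hG⟩ := hrec (‖p₀‖ + 2 * a) ε hε
  obtain ⟨g₀, -, hg₀, -⟩ := hG p₀ hp₀
  refine ⟨G + ‖p₀‖ + 3 * a, by linarith [dist_nonneg.trans hg₀, norm_nonneg p₀], fun y => ?_⟩
  obtain ⟨w, hwZ, hwy⟩ := hdense y
  obtain ⟨g, -, hgw, hBM⟩ := hG w hwZ
  obtain ⟨q, ⟨p', hp'Z, rfl⟩, hqp⟩ := hBM.1 p₀ hp₀ (by rw [dist_zero_right]; linarith)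
  have hqp : dist (p' - g) p₀ ≤ ε := hqp
  have hmatch : ∀ w₁ ∈ bondShell a Z p₀, ∃ w' ∈ Z, dist (w' - g) w₁ ≤ ε := by
    intro w₁ hw₁
    have h1 := dist_triangle w₁ p₀ (0 : EuclideanSpace ℝ (Fin 3))
    rw [dist_zero_right p₀, dist_comm w₁ p₀] at h1
    obtain ⟨q, ⟨w', hw'Z, rfl⟩, hd⟩ := hBM.1 w₁ hw₁.1 (by linarith [hw₁.2.2])
    exact ⟨w', hw'Z, hd⟩
  obtain ⟨f, hf⟩ := closing_shellEquiv ha (by linarith) hgap hp₀ hp'Z hqp hmatch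
  have hlip := (abs_le.1 (hK p₀ p' (2 * ε) (by linarith) (by linarith) ⟨f, hf⟩)).2
  refine ⟨p', hp'Z, ?_, by linarith⟩
  have h1 : dist p' w ≤ ε + ‖p₀‖ + G :=
    calc dist p' w = ‖(p' - g - p₀) + p₀ + (g - w)‖ := by rw [dist_eq_norm]; congr 1; abel
      _ ≤ ‖p' - g - p₀‖ + ‖p₀‖ + ‖g - w‖ := norm_add₃_le
      _ ≤ ε + ‖p₀‖ + G := by rw [← dist_eq_norm, ← dist_eq_norm]; linarith
  linarith [dist_triangle p' w y]

/-- **Stub R3b (density closing at the set for the laminar defect).** A rooted, everywhere-clean, rooted-uniformly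
recurrent, charted hull element of a Lennard-Jones ground-state sequence has identically vanishing laminar defect, given laminar
coercivity (used only AT this set) and the Lipschitz property of the laminar defect under shell bijections (taken as a
hypothesis). Proof: the landed `CleanHull.stub_closing` with `laminarDefect` for `localDefect` — (A) surface order from
above by (U) = `LayeredHull.stub_windowBounds` + `stub_ballBoundarySum` against the coercivity; (B) recurrence transfer
(`closing_shellEquiv`, `laminarClosing_recur`); (C) volume order from below by `stub_gridCount`; `closing_endgame`.
Relative denseness from the landed `stub_relDense`. [folklore] -/
theorem stub_laminarDensityClosing :
    (∃ κ C : ℝ, 0 < κ ∧ ∀ (Z : Set (EuclideanSpace ℝ (Fin 3))) (a : ℝ), 47 / 50 ≤ a → a ≤ 1 →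
      (∀ y ∈ Z, ({w ∈ Z | w ≠ y ∧ dist y w ≤ a * (1 + 1 / 50)}.ncard = 12 ∧
          ∀ w ∈ Z, w ≠ y → a * (1 - 1 / 50) ≤ dist y w ∧
            (dist y w ≤ a * (1 + 1 / 50) ∨ a * (63 / 50) ≤ dist y w)) ∧
        ∃ T : Finset (EuclideanSpace ℝ (Fin 3)), (↑T : Set (EuclideanSpace ℝ (Fin 3))) =
            (fun w => a⁻¹ • (w - y)) '' {w ∈ Z | w ≠ y ∧ dist y w ≤ a * (1 + 1 / 50)} ∧
          (ShellCloseTo (1 / 5) T fccKissingPattern ∨ ShellCloseTo (1 / 5) T hcpKissingPattern)) →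
      (∃ (s : ℤ → ℤ) (Φ : EuclideanSpace ℝ (Fin 3) → EuclideanSpace ℝ (Fin 3)), IsHaggSeq s ∧
        Set.BijOn Φ (barlowStacking 1 (Real.sqrt (2 / 3)) s) Z ∧
        ∀ p ∈ barlowStacking 1 (Real.sqrt (2 / 3)) s, ∀ q ∈ barlowStacking 1 (Real.sqrt (2 / 3)) s, p ≠ q →
          (dist p q = 1 ↔ dist (Φ p) (Φ q) ≤ a * (1 + 1 / 50))) →
      ∀ (c : EuclideanSpace ℝ (Fin 3)) (L : ℝ), 1 ≤ L → ∀ W : Finset (EuclideanSpace ℝ (Fin 3)),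
        (↑W : Set (EuclideanSpace ℝ (Fin 3))) = Z ∩ Metric.closedBall c L →
        2 * groundStateEnergy lennardJones 3 W.card - C * L ^ 2 + κ * ∑ p ∈ W, laminarDefect a Z p ≤
          ∑ p ∈ W, siteEnergy Z p) →
    (∀ a : ℝ, 0 < a → ∃ K : ℝ, ∀ (Z Z' : Set (EuclideanSpace ℝ (Fin 3))) (p p' : EuclideanSpace ℝ (Fin 3)) (ε : ℝ),
      0 ≤ ε → ε ≤ a →
      (∃ f : ↥(bondShell a Z p) ≃ ↥(bondShell a Z' p'),
        ∀ w : ↥(bondShell a Z p), dist ((f w : EuclideanSpace ℝ (Fin 3)) - p') ((w : EuclideanSpace ℝ (Fin 3)) - p) ≤ ε) →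
      |laminarDefect a Z p - laminarDefect a Z' p'| ≤ K * ε) →
    ∀ x : (N : ℕ) → (Fin N → EuclideanSpace ℝ (Fin 3)),
    (∀ N, IsGroundState lennardJones (x N)) →
    ∀ (Z : Set (EuclideanSpace ℝ (Fin 3))) (a : ℝ), 47 / 50 ≤ a → a ≤ 1 → (0 : EuclideanSpace ℝ (Fin 3)) ∈ Z →
    (∀ R ε : ℝ, 0 < ε → ∃ᶠ N in Filter.atTop, ∃ t : EuclideanSpace ℝ (Fin 3), (∀ p ∈ Z, ‖p‖ ≤ R →
        ∃ i : Fin N, dist (x N i + t) p ≤ ε) ∧ (∀ i : Fin N, ‖x N i + t‖ ≤ R → ∃ p ∈ Z, dist (x N i + t) p ≤ ε)) →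
    (∀ y ∈ Z, ({w ∈ Z | w ≠ y ∧ dist y w ≤ a * (1 + 1 / 50)}.ncard = 12 ∧ ∀ w ∈ Z, w ≠ y →
        a * (1 - 1 / 50) ≤ dist y w ∧ (dist y w ≤ a * (1 + 1 / 50) ∨ a * (63 / 50) ≤ dist y w)) ∧
        (∃ T : Finset (EuclideanSpace ℝ (Fin 3)),
        (↑T : Set (EuclideanSpace ℝ (Fin 3))) = (fun w => a⁻¹ • (w - y)) ''
            {w ∈ Z | w ≠ y ∧ dist y w ≤ a * (1 + 1 / 50)} ∧
            (ShellCloseTo (1 / 5) T fccKissingPattern ∨ ShellCloseTo (1 / 5) T hcpKissingPattern))) →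
    (∀ R ε : ℝ, 0 < ε → ∃ G : ℝ, ∀ w ∈ Z, ∃ g ∈ Z, dist g w ≤ G ∧ BallMatch ε R 0 ((fun p => p - g) '' Z) Z) →
    (∃ (s : ℤ → ℤ) (Φ : EuclideanSpace ℝ (Fin 3) → EuclideanSpace ℝ (Fin 3)), IsHaggSeq s ∧
      Set.BijOn Φ (barlowStacking 1 (Real.sqrt (2 / 3)) s) Z ∧
      ∀ p ∈ barlowStacking 1 (Real.sqrt (2 / 3)) s, ∀ q ∈ barlowStacking 1 (Real.sqrt (2 / 3)) s, p ≠ q →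
        (dist p q = 1 ↔ dist (Φ p) (Φ q) ≤ a * (1 + 1 / 50))) →
    ∀ p ∈ Z, laminarDefect a Z p = 0 := by
  classical
  intro hcoer hlipK x hx Z a ha ha1 h0 hH hclean hrec hchart p₀ hp₀
  by_contra hne0
  have hη : 0 < laminarDefect a Z p₀ := lt_of_le_of_ne (laminarDefect_nonneg a Z p₀) (Ne.symm hne0)
  have ha0 : 0 < a := by linarith
  have hsep : ∀ p ∈ Z, ∀ q ∈ Z, p ≠ q → a * (1 - 1 / 50) ≤ dist p q :=
    fun p hp q hq hpq => ((hclean p hp).1.2 q hq hpq.symm).1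
  -- relative denseness of the rooted clean set
  have hdense : ∀ y : EuclideanSpace ℝ (Fin 3), ∃ w ∈ Z, dist w y ≤ 2 * a :=
    stub_relDense a ha0 Z ⟨0, h0⟩ hclean
  -- constants
  obtain ⟨κ, C, hκ, hco⟩ := hcoer
  obtain ⟨CU, hU⟩ := LayeredHull.stub_windowBounds.1
  obtain ⟨CB, hB⟩ := stub_ballBoundarySum (a * (1 - 1 / 50)) (by positivity)
  obtain ⟨K, hK⟩ := hlipK a ha0
  -- (A) the summed laminar defect over balls is of surface order
  have hA : ∀ (c : EuclideanSpace ℝ (Fin 3)) (L : ℝ), 1 ≤ L → ∀ W : Finset (EuclideanSpace ℝ (Fin 3)),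
      (↑W : Set (EuclideanSpace ℝ (Fin 3))) = Z ∩ Metric.closedBall c L →
      κ * ∑ p ∈ W, laminarDefect a Z p ≤ (C + max CU 0 * CB) * L ^ 2 := by
    intro c L hL W hW
    have hout : ∃ q ∈ Z, L < dist q c := by
      obtain ⟨w, hw, hwd⟩ := hdense (c + EuclideanSpace.single 0 (L + 3))
      refine ⟨w, hw, ?_⟩
      have h1 : dist (c + EuclideanSpace.single 0 (L + 3)) c = L + 3 := by
        rw [dist_eq_norm, add_sub_cancel_left, PiLp.norm_single, Real.norm_eq_abs,
          abs_of_nonneg (by linarith)]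
      linarith [dist_triangle_left (c + EuclideanSpace.single 0 (L + 3)) c w]
    have hWZ : (↑W : Set (EuclideanSpace ℝ (Fin 3))) ⊆ Z := hW ▸ Set.inter_subset_left
    have h1 := hB Z hsep c L hL hout W hW
    have h2 := hU x hx Z hH W hWZ
    have h3 := hco Z a ha ha1 hclean hchart c L hL W hW
    have h0 : 0 ≤ ∑ p ∈ W, (1 + Metric.infDist p (Z \ (↑W : Set (EuclideanSpace ℝ (Fin 3)))))⁻¹ ^ 3 :=
      Finset.sum_nonneg fun p _ =>
        pow_nonneg (inv_nonneg.2 (add_nonneg zero_le_one Metric.infDist_nonneg)) 3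
    have h4 : CU * ∑ p ∈ W, (1 + Metric.infDist p (Z \ (↑W : Set (EuclideanSpace ℝ (Fin 3)))))⁻¹ ^ 3 ≤
        max CU 0 * (CB * L ^ 2) :=
      (mul_le_mul_of_nonneg_right (le_max_left CU 0) h0).trans
        (mul_le_mul_of_nonneg_left h1 (le_max_right CU 0))
    simp only [siteEnergy] at h3
    nlinarith
  -- (B) recurrence transfer: sites of laminar defect `≥ η/2` within distance `D` of every point
  obtain ⟨D, hD0, hD⟩ := laminarClosing_recur ha0 (laminarDefect a Z) K
    (fun p p' ε h0 h1 hf => hK Z Z p p' ε h0 h1 hf) (fun y hy => (hclean y hy).1) hrec hdense hp₀ hη le_rfl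
  choose φ hφZ hφd hφη using hD
  -- (C) counting on large balls about `0`
  have hG' : 1 ≤ D + 1 := by linarith
  refine closing_endgame (A := κ * (laminarDefect a Z p₀ / 2) / (8 * (D + 1)) ^ 3)
    (M := C + max CU 0 * CB) (L₀ := 8 * (D + 1)) (by positivity) (by positivity) fun L hL => ?_
  obtain ⟨P, hPball, hPsep, hPcard⟩ := stub_gridCount (D + 1) L hG' hL (0 : EuclideanSpace ℝ (Fin 3))
  have hfin : (Z ∩ Metric.closedBall (0 : EuclideanSpace ℝ (Fin 3)) L).Finite :=
    finite_of_forall_le_dist_of_subset_closedBall (by positivity : (0 : ℝ) < a * (1 - 1 / 50))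
      (fun p hp q hq hpq => hsep p hp.1 q hq.1 hpq) Set.inter_subset_right
  have hW : (↑hfin.toFinset : Set (EuclideanSpace ℝ (Fin 3))) = Z ∩ Metric.closedBall 0 L := hfin.coe_toFinset
  have hAW := hA 0 L (by linarith) hfin.toFinset hW
  have hinj : Set.InjOn φ ↑P := by
    intro y hy y' hy' hyy
    by_contra hne
    have h1 := hPsep y hy y' hy' hne
    have h2 : dist y y' ≤ D + D :=
      calc dist y y' ≤ dist (φ y) y + dist (φ y) y' := dist_triangle_left _ _ _
        _ ≤ D + D := add_le_add (hφd y) (by rw [hyy]; exact hφd y')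
    linarith
  have hsub : P.image φ ⊆ hfin.toFinset := by
    intro p hp
    obtain ⟨y, hy, rfl⟩ := Finset.mem_image.1 hp
    rw [← Finset.mem_coe, hW]
    refine ⟨hφZ y, Metric.mem_closedBall.2 ?_⟩
    have h1 : dist y 0 ≤ L / 2 := Metric.mem_closedBall.1 (hPball (Finset.mem_coe.2 hy))
    linarith [dist_triangle (φ y) y 0, hφd y]
  have hsum : (P.card : ℝ) * (laminarDefect a Z p₀ / 2) ≤ ∑ p ∈ hfin.toFinset, laminarDefect a Z p :=
    calc (P.card : ℝ) * (laminarDefect a Z p₀ / 2)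
          = ∑ p ∈ P.image φ, laminarDefect a Z p₀ / 2 := by
            rw [Finset.sum_const, nsmul_eq_mul, Finset.card_image_of_injOn hinj]
      _ ≤ ∑ p ∈ P.image φ, laminarDefect a Z p := Finset.sum_le_sum fun p hp => by
            obtain ⟨y, -, rfl⟩ := Finset.mem_image.1 hp; exact hφη y
      _ ≤ ∑ p ∈ hfin.toFinset, laminarDefect a Z p :=
            Finset.sum_le_sum_of_subset_of_nonneg hsub fun p _ _ => laminarDefect_nonneg a Z p
  have hD1 : (0 : ℝ) < 8 * (D + 1) := by positivity
  calc κ * (laminarDefect a Z p₀ / 2) / (8 * (D + 1)) ^ 3 * L ^ 3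
        = κ * ((L / (8 * (D + 1))) ^ 3 * (laminarDefect a Z p₀ / 2)) := by
          field_simp
    _ ≤ κ * ((P.card : ℝ) * (laminarDefect a Z p₀ / 2)) := by gcongr
    _ ≤ κ * ∑ p ∈ hfin.toFinset, laminarDefect a Z p := by gcongr
    _ ≤ (C + max CU 0 * CB) * L ^ 2 := hAW

end Summit.AtomisticToContinuum.Crystallization.Theorems.CleanHull

end
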